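import Mathlib
import HarnessLib
import Summits.ValiantsHypothesis.ValiantsHypothesis.Theses.MonotoneRestoration
import Literature.Computability.AlgebraicComplexity.SymmetricCircuitFold

/-! # Route MonotoneRestoration — crux `MonotoneRestorationQP`, line Sketch, stub Z3
(stmt-ValiantsHypothesis-15886)

**Folding an output family of a symmetric circuit (orbit sums and orbit products).** If a
`Γ`-symmetric Dawar–Wilsenach labelled arithmetic circuit over constants `K` and variables `X`
computes the family `(g_y)_{y ∈ Y}` at outputs indexed by a finite nonempty `Γ`-set `Y`, then
`Σ_y g_y` and `Π_y g_y` are each computed by a `Γ`-symmetric single-output circuit on at most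
`|G| + 1` gates (e.g. the trace `Σ_i M_ii`, the sum of all entries, the product over an orbit).

Proof: the universe-`0` instances of the tree lemmas
`LabelledArithCircuit.IsSymmetric.exists_sumOutputs` and
`LabelledArithCircuit.IsSymmetric.exists_prodOutputs`
(`Literature/Computability/AlgebraicComplexity/SymmetricCircuitFold.lean`): gate set `G ⊕ Unit`,
one new `+` (resp. `×`) gate over the set of output gates, fixed by every extended automorphism
`π ⊕ id` because the output gates are permuted among themselves.
-/

noncomputable section

-- `Summit.ValiantsHypothesis.ValiantsHypothesis.…` is the tree's mandated namespace (Sub = Summit).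
set_option linter.dupNamespace false

namespace Summit.ValiantsHypothesis.ValiantsHypothesis.Theorems

open Literature.Computability.AlgebraicComplexity

/-- **Z3 — folding an output family (orbit sums and orbit products)** (crux
`MonotoneRestorationQP`, line Sketch; registered stub `stub_symmetric_foldOutputs`): if a
`Γ`-symmetric circuit computes `(g_y)_{y ∈ Y}` at outputs indexed by a finite nonempty `Γ`-set
`Y`, then `Σ_y g_y` and `Π_y g_y` are each computed by a `Γ`-symmetric single-output circuit on
at most `|G| + 1` gates. Instance of `LabelledArithCircuit.IsSymmetric.exists_sumOutputs` and
`LabelledArithCircuit.IsSymmetric.exists_prodOutputs`. -/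
theorem stub_symmetric_foldOutputs {K X Y Γ G : Type} [CommSemiring K] [Group Γ] [MulAction Γ X]
    [MulAction Γ Y] [MulAction Γ Unit] [Fintype Y] [Nonempty Y] [Fintype G]
    (C : LabelledArithCircuit K X Y G) (hC : C.IsSymmetric Γ) :
    (∃ (G' : Type) (_ : Fintype G') (C' : LabelledArithCircuit K X Unit G'),
      C'.IsSymmetric Γ ∧ C'.eval (C'.output ()) = ∑ y, C.eval (C.output y) ∧
      Fintype.card G' ≤ Fintype.card G + 1) ∧
    (∃ (G' : Type) (_ : Fintype G') (C' : LabelledArithCircuit K X Unit G'),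
      C'.IsSymmetric Γ ∧ C'.eval (C'.output ()) = ∏ y, C.eval (C.output y) ∧
      Fintype.card G' ≤ Fintype.card G + 1) :=
  ⟨hC.exists_sumOutputs, hC.exists_prodOutputs⟩

end Summit.ValiantsHypothesis.ValiantsHypothesis.Theorems

end
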